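import Literature.Geometry.Riemannian.NeumannChartTransfer
import Literature.Geometry.Riemannian.BoundaryFlatteningChart
import Literature.Geometry.Lorentzian.WeakSolutionRegularity
import Literature.Analysis.PDE.NeumannHalfBallSmoothRep
import Literature.Analysis.PDE.HalfBallDivergenceTheorem
import Literature.Analysis.PDE.DivFormInteriorSmoothRep
import Mathlib.Geometry.Manifold.PartitionOfUnity
import HarnessLib

/-!
# `C²` representatives of the weak Neumann solution near boundary points, with the boundary
# condition `⟨∇w, ∇σ⟩ = 0`

Topic `Geometry/Riemannian`. Theorem file (no definitions, no named facts; everything proved), on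
the discharge path of `Literature.Geometry.Riemannian.sharpLogSobolevAVR_four` (dimension four).

For the weak solution of the Neumann problem `div_h(f∇u) = F` on the regular sub-level domain
`D = {σ < 0}` produced by `exists_smooth_weakNeumann_approx` (approximants `uₙ`, `L²` limit `v`),
and a boundary point `x₀` (`σ x₀ = 0`, `dσ_{x₀} ≠ 0`): there are an open `V ∋ x₀` and `w ∈ C²(M)`
with `w = v` a.e. on `V ∩ D` and `h⁻¹(dw, dσ) = 0` on `V ∩ {σ = 0}`
(`exists_boundary_representative`). Proof: the boundary-flattening composite chart
(`BoundaryFlatteningChart.lean`), the chart transfer (`NeumannChartTransfer.lean`), the `L²`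
boundary regularity on half-balls with the Morrey representative
(`NeumannHalfBallSmoothRep.lean`), the pointwise conormal condition
(`HalfBallDivergenceTheorem.lean`), read back on the manifold through the composite-chart energy
identity (`CompositeChartEnergy.lean`), and a smooth cut-off. Also the null-set transfer
`ae_compositePiece_of_ae`.

## References

* M. E. Taylor, *Partial Differential Equations I*, 2nd ed. (2011), Ch. 5 §7, Prop. 7.4 and
  (7.13)–(7.14). [TaylorPDEI2011]
* L. C. Evans, *Partial Differential Equations*, 2nd ed. (2010), §6.3.2. [Evans2010]
-/

noncomputable section

open MeasureTheory Measure Set Filter Metric Module InnerProductSpace TopologicalSpace Function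
open scoped ENNReal NNReal Manifold ContDiff Topology RealInnerProductSpace Gradient

namespace Literature.Geometry.Riemannian

open Lorentzian
open Bundle PseudoRiemannianMetric Literature.Analysis.FunctionSpaces Literature.Analysis.PDE

variable {m : ℕ} {M : Type*} [TopologicalSpace M] [ChartedSpace (EuclideanSpace ℝ (Fin m)) M]
  [IsManifold (𝓡 m) ∞ M] [T2Space M] [LocallyCompactSpace M] [SigmaCompactSpace M]
  [MeasurableSpace M] [BorelSpace M]
  (h : ContMDiffRiemannianMetric (𝓡 m) ∞ (EuclideanSpace ℝ (Fin m)) (TangentSpace (𝓡 m) : M → Type _))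

/-- **Null sets transfer through a composite chart**: a property holding Lebesgue-a.e. on
`Q ⊆ Ψ.target` holds `μ_h`-a.e. on the piece `φ⁻¹(Ψ⁻¹(Q))` of the chart domain (the inverse chart
`Ψ⁻¹` is differentiable, so it maps null sets to null sets; then
`ae_comp_extChartAt_of_ae_target`). [folklore] -/
theorem ae_compositePiece_of_ae (x : M)
    {Ψ : OpenPartialHomeomorph (EuclideanSpace ℝ (Fin m)) (EuclideanSpace ℝ (Fin m))}
    (hΨ'd : DifferentiableOn ℝ Ψ.symm Ψ.target) {Q : Set (EuclideanSpace ℝ (Fin m))}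
    (hQt : Q ⊆ Ψ.target) {P' : EuclideanSpace ℝ (Fin m) → Prop}
    (hae : ∀ᵐ w ∂(volume : Measure (EuclideanSpace ℝ (Fin m))), w ∈ Q → P' w) :
    ∀ᵐ p ∂riemannianMeasure h,
      p ∈ (extChartAt (𝓡 m) x).source ∩ extChartAt (𝓡 m) x ⁻¹' (Ψ.symm '' Q) →
        P' (Ψ (extChartAt (𝓡 m) x p)) := by
  set N : Set (EuclideanSpace ℝ (Fin m)) := {w | w ∈ Q ∧ ¬ P' w} with hN
  have hN0 : volume N = 0 := by
    rw [ae_iff] at hae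
    refine measure_mono_null (fun w hw ↦ ?_) hae
    exact fun h' ↦ hw.2 (h' hw.1)
  have hN0' : volume (Ψ.symm '' N) = 0 :=
    addHaar_image_eq_zero_of_differentiableOn_of_addHaar_eq_zero _
      (hΨ'd.mono fun w hw ↦ hQt hw.1) hN0
  have hae' : ∀ᵐ y ∂(volume : Measure (EuclideanSpace ℝ (Fin m))), y ∈ (univ : Set _) →
      y ∉ Ψ.symm '' N := by
    have := compl_mem_ae_iff.2 hN0'
    filter_upwards [this] with y hy _ using hy
  have h1 := ae_comp_extChartAt_of_ae_target h x hae'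
  filter_upwards [h1] with p hp hpQ
  obtain ⟨hps, w, hwQ, hw⟩ := hpQ
  have hΨw : Ψ (extChartAt (𝓡 m) x p) = w := by rw [← hw, Ψ.right_inv (hQt hwQ)]
  rw [hΨw]
  by_contra hPw
  exact hp hps (mem_univ _) ⟨w, ⟨hwQ, hPw⟩, hw⟩

omit [T2Space M] [LocallyCompactSpace M] [SigmaCompactSpace M] [MeasurableSpace M] [BorelSpace M] in
/-- The gradient of `w ↦ ⟪w - z, ν⟫` is `ν`. [folklore] -/
theorem gradient_inner_sub_const (z ν w : EuclideanSpace ℝ (Fin m)) :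
    gradient (fun y : EuclideanSpace ℝ (Fin m) ↦ ⟪y - z, ν⟫) w = ν := by
  have e : (fun y : EuclideanSpace ℝ (Fin m) ↦ ⟪y - z, ν⟫) =
      fun y ↦ (InnerProductSpace.toDual ℝ _ ν) y - ⟪z, ν⟫ := by
    funext y; rw [InnerProductSpace.toDual_apply_apply, inner_sub_left, real_inner_comm]
  rw [e, gradient, fderiv_sub_const, ContinuousLinearMap.fderiv]
  exact (InnerProductSpace.toDual ℝ _).symm_apply_apply ν

variable (g : PseudoRiemannianMetric (𝓡 m) ∞ (EuclideanSpace ℝ (Fin m))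
  (TangentSpace (𝓡 m) : M → Type _))

omit [MeasurableSpace M] [BorelSpace M] in
/-- A smooth cut-off equal to `1` near a point and supported in a given open neighbourhood.
[folklore] -/
theorem exists_cutoff_one_nhds {V₀ : Set M} (hV₀ : IsOpen V₀) {x₀ : M} (hx₀ : x₀ ∈ V₀) :
    ∃ (θ : M → ℝ) (V : Set M), ContMDiff (𝓡 m) 𝓘(ℝ, ℝ) ∞ θ ∧ IsOpen V ∧ x₀ ∈ V ∧ V ⊆ V₀ ∧
      (∀ x ∈ V, θ x = 1) ∧ tsupport θ ⊆ V₀ := by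
  obtain ⟨L, hLc, hxL, hLV₀⟩ := exists_compact_between isCompact_singleton hV₀
    (singleton_subset_iff.2 hx₀)
  obtain ⟨θ, hθ0, hθ1, -⟩ := exists_contMDiffMap_zero_one_nhds_of_isClosed (I := 𝓡 m) (n := (⊤ : ℕ∞))
    hV₀.isClosed_compl hLc.isClosed (disjoint_compl_left_iff.2 hLV₀)
  obtain ⟨U, hUo, hVU, hU0⟩ : ∃ U : Set M, IsOpen U ∧ V₀ᶜ ⊆ U ∧ ∀ x ∈ U, θ x = 0 := by
    obtain ⟨U, hUo, hsub, hU⟩ := eventually_nhdsSet_iff_exists.1 hθ0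
    exact ⟨U, hUo, hsub, hU⟩
  obtain ⟨W, -, hLW, hW1⟩ : ∃ W : Set M, IsOpen W ∧ L ⊆ W ∧ ∀ x ∈ W, θ x = 1 := by
    obtain ⟨W, hWo, hsub, hW⟩ := eventually_nhdsSet_iff_exists.1 hθ1
    exact ⟨W, hWo, hsub, hW⟩
  refine ⟨θ, interior L, θ.contMDiff, isOpen_interior, hxL (mem_singleton x₀),
    interior_subset.trans hLV₀, fun x hx ↦ hW1 x (hLW (interior_subset hx)), ?_⟩
  have hsupp : support (θ : M → ℝ) ⊆ Uᶜ := fun x hx hxU ↦ hx (hU0 x hxU)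
  exact (closure_minimal hsupp hUo.isClosed_compl).trans (compl_subset_comm.1 hVU)

set_option maxHeartbeats 3200000 in
/-- **`C²` representative near a boundary point, with the boundary condition** (Taylor, *PDE I*,
Ch. 5 §7, Prop. 7.4 with (7.13)–(7.14); Evans, *PDE*, §6.3.2 Thm. 5; in dimension four). See the
module docstring. [cite: TaylorPDEI2011, Ch. 5 §7, Proposition 7.4] -/
theorem exists_boundary_representative [g.HasLeviCivita] (hg : g.IsRiemannian)
    (hm4 : Module.finrank ℝ (EuclideanSpace ℝ (Fin m)) = 4)
    {σ : M → ℝ} (hσ : ContMDiff (𝓡 m) 𝓘(ℝ, ℝ) ∞ σ) (hcpt : IsCompact {x | σ x ≤ 0})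
    {u : ℕ → M → ℝ} {v : M → ℝ} (hus : ∀ n, ContMDiff (𝓡 m) 𝓘(ℝ, ℝ) ∞ (u n))
    (hvm : MemLp v 2 ((riemannianMeasure (g.toContMDiffRiemannianMetric hg)).restrict {x | σ x < 0}))
    (hL2 : Tendsto (fun n ↦ eLpNorm (u n - v) 2
      ((riemannianMeasure (g.toContMDiffRiemannianMetric hg)).restrict {x | σ x < 0})) atTop (𝓝 0))
    (hE : ∀ ε > 0, ∃ N, ∀ n ≥ N, ∀ n' ≥ N, ∫ p in {x | σ x < 0}, g.gradSq (u n - u n') p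
      ∂riemannianMeasure (g.toContMDiffRiemannianMetric hg) < ε)
    {f : M → ℝ} (hf : ContMDiff (𝓡 m) 𝓘(ℝ, ℝ) ∞ f) (hfpos : ∀ x, 0 < f x)
    {F : M → ℝ} (hF : ContMDiff (𝓡 m) 𝓘(ℝ, ℝ) ∞ F)
    (hweak : ∀ w : M → ℝ, ContMDiff (𝓡 m) 𝓘(ℝ, ℝ) ∞ w →
      Tendsto (fun n ↦ ∫ p in {x | σ x < 0}, f p * g.innerDual p (mvfderiv (𝓡 m) (u n) p).toLinearMap
        (mvfderiv (𝓡 m) w p).toLinearMap ∂riemannianMeasure (g.toContMDiffRiemannianMetric hg))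
        atTop (𝓝 (-∫ p in {x | σ x < 0}, F p * w p
          ∂riemannianMeasure (g.toContMDiffRiemannianMetric hg))))
    {x₀ : M} (hx₀ : σ x₀ = 0) (hreg : mfderiv (𝓡 m) 𝓘(ℝ, ℝ) σ x₀ ≠ 0) :
    ∃ V : Set M, IsOpen V ∧ x₀ ∈ V ∧ ∃ w : M → ℝ, ContMDiff (𝓡 m) 𝓘(ℝ, ℝ) 2 w ∧
      (∀ᵐ p ∂riemannianMeasure (g.toContMDiffRiemannianMetric hg), p ∈ V → σ p < 0 → w p = v p) ∧
      ∀ q ∈ V, σ q = 0 → g.innerDual q (mvfderiv (𝓡 m) w q).toLinearMap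
        (mvfderiv (𝓡 m) σ q).toLinearMap = 0 := by
  classical
  set h := g.toContMDiffRiemannianMetric hg with hh_def
  haveI : (ofRiemannian h).HasLeviCivita := ‹g.HasLeviCivita›
  set μ : Measure M := riemannianMeasure h with hμ
  set φ := extChartAt (𝓡 m) x₀ with hφ
  set D : Set M := {x | σ x < 0} with hD
  have hDo : IsOpen D := isOpen_lt hσ.continuous continuous_const
  have hDm : MeasurableSet D := hDo.measurableSet
  have hDKD : D ⊆ {x | σ x ≤ 0} := fun x (hx : σ x < 0) ↦ hx.le
  /- Step 1: the flattening chart and the radii -/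
  obtain ⟨Ψ, ν, R, hν, hR, hΨt, hzΨ, hΨz, hΨ, hΨ', hballR, hlin⟩ :=
    exists_boundaryFlatteningChart hσ hx₀ hreg
  set z : EuclideanSpace ℝ (Fin m) := φ x₀ with hz
  have hΨd : DifferentiableOn ℝ Ψ Ψ.source := hΨ.differentiableOn (by simp)
  have hΨ'd : DifferentiableOn ℝ Ψ.symm Ψ.target := hΨ'.differentiableOn (by simp)
  have hΨ'1 : ContDiffOn ℝ 1 Ψ.symm Ψ.target := hΨ'.of_le (by norm_cast)
  have hdΨ : ∀ w ∈ Ψ.target, DifferentiableAt ℝ Ψ (Ψ.symm w) := fun w hw ↦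
    (hΨd _ (Ψ.map_target hw)).differentiableAt (Ψ.open_source.mem_nhds (Ψ.map_target hw))
  have hdΨ' : ∀ w ∈ Ψ.target, DifferentiableAt ℝ Ψ.symm w := fun w hw ↦
    (hΨ'd _ hw).differentiableAt (Ψ.open_target.mem_nhds hw)
  set r : ℝ := R / 4 with hr_def
  have hr : 0 < r := by positivity
  have hrR : r < R := by rw [hr_def]; linarith
  have hball : closedBall z r ⊆ Ψ.target := (closedBall_subset_closedBall hrR.le).trans hballR
  have hBt : ball z r ⊆ Ψ.target := ball_subset_closedBall.trans hball
  have hBRt : ball z R ⊆ Ψ.target := ball_subset_closedBall.trans hballR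
  -- the half-ball and the piece of `D` over it
  set Q : Set (EuclideanSpace ℝ (Fin m)) := (halfBall ν z r : Set (EuclideanSpace ℝ (Fin m))) with hQ
  have hQo : IsOpen Q := (halfBall ν z r).isOpen
  have hQB : Q ⊆ ball z r := halfBall_subset_ball
  have hDQ : D ∩ (φ.source ∩ φ ⁻¹' (Ψ.symm '' ball z r)) = φ.source ∩ φ ⁻¹' (Ψ.symm '' Q) := by
    rw [hD, hQ, sublevel_inter_compositePiece hlin hBt]
    rfl
  /- Step 2: the chart transfer -/
  obtain ⟨ut, gu, hutm, hgum, hW, hae, -, -, hweakE⟩ := exists_weakNeumann_chartTransfer g hg x₀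
    hΨt hΨ hΨ' hball hQo hQB hDm hcpt hDKD hDQ hus hvm hL2 hE hf.continuous hF.continuous hweak
  /- Step 3: the coefficients `A₀ = (ρ f̃) M` and the source `F_E = -ρ F̃` -/
  obtain ⟨ρ, hρ⟩ : ∃ ρ : EuclideanSpace ℝ (Fin m) → ℝ, ∀ w, ρ w =
      |(fderiv ℝ Ψ.symm w).det| * Real.sqrt (chartGramMatrix h x₀ (Ψ.symm w)).det :=
    ⟨_, fun _ ↦ rfl⟩
  obtain ⟨Mf, hMf⟩ : ∃ Mf : EuclideanSpace ℝ (Fin m) → EuclideanSpace ℝ (Fin m) →L[ℝ]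
      EuclideanSpace ℝ (Fin m), ∀ w, Mf w = ∑ i, ∑ j, (chartGramMatrix h x₀ (Ψ.symm w))⁻¹ i j •
        (innerSL ℝ (fderiv ℝ Ψ (Ψ.symm w) (EuclideanSpace.single i 1))).smulRight
          (fderiv ℝ Ψ (Ψ.symm w) (EuclideanSpace.single j 1)) := ⟨_, fun _ ↦ rfl⟩
  obtain ⟨Φi, hΦi⟩ : ∃ Φi : EuclideanSpace ℝ (Fin m) → M, ∀ w, Φi w = φ.symm (Ψ.symm w) :=
    ⟨_, fun _ ↦ rfl⟩
  obtain ⟨A₀, hA₀_apply⟩ : ∃ A₀ : EuclideanSpace ℝ (Fin m) → EuclideanSpace ℝ (Fin m) →L[ℝ]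
      EuclideanSpace ℝ (Fin m), ∀ w, A₀ w = (ρ w * f (Φi w)) • Mf w := ⟨_, fun _ ↦ rfl⟩
  obtain ⟨FE, hFE_apply⟩ : ∃ FE : EuclideanSpace ℝ (Fin m) → ℝ, ∀ w, FE w = -(ρ w * F (Φi w)) :=
    ⟨_, fun _ ↦ rfl⟩
  -- smoothness on `B(z,R)`
  have hρs : ContDiffOn ℝ ∞ ρ (ball z R) :=
    (contDiffOn_compositeDensity_of_convex h x₀ hΨt hΨ hΨ' (convex_ball z R) hBRt).congr
      fun w _ ↦ hρ w
  have hMs : ContDiffOn ℝ ∞ Mf Ψ.target :=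
    (contDiffOn_compositeCoeff h x₀ hΨt hΨ hΨ').congr fun w _ ↦ hMf w
  have hcompΦ : ∀ {k : M → ℝ}, ContMDiff (𝓡 m) 𝓘(ℝ, ℝ) ∞ k →
      ContDiffOn ℝ ∞ (fun w ↦ k (Φi w)) Ψ.target := by
    intro k hk
    have h1 : ContDiffOn ℝ ∞ (k ∘ φ.symm) φ.target := contDiffOn_comp_extChartAt_symm hk
    have h2 := h1.comp hΨ' fun w hw ↦ hΨt (Ψ.map_target hw)
    exact h2.congr fun w _ ↦ by rw [hΦi]; rfl
  have hA₀ : ContDiffOn ℝ ∞ A₀ (ball z R) := by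
    have := (hρs.mul ((hcompΦ hf).mono hBRt)).smul (hMs.mono hBRt)
    exact this.congr fun w _ ↦ hA₀_apply w
  have hFE : ContDiffOn ℝ ∞ FE (ball z R) := by
    have := (hρs.mul ((hcompΦ hF).mono hBRt)).neg
    exact this.congr fun w _ ↦ hFE_apply w
  -- ellipticity on `B̄(z,R/2)`
  set K₂ : Set (EuclideanSpace ℝ (Fin m)) := closedBall z (R / 2) with hK₂
  have hK₂c : IsCompact K₂ := isCompact_closedBall _ _
  have hK₂t : K₂ ⊆ Ψ.target := (closedBall_subset_closedBall (by linarith)).trans hballR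
  obtain ⟨lamρ, Lamρ, hlamρ, hleρ, hdens⟩ :=
    exists_compositeDensity_bounds h x₀ hΨt hΨd hΨ'1 hK₂c hK₂t
  obtain ⟨lamM, LamM, hlamM, hleM, hMb⟩ := exists_compositeCoeff_bounds h x₀ hΨt hΨ hΨ' hK₂c hK₂t
  have hΦic : ContinuousOn Φi Ψ.target := by
    have : ContinuousOn (fun w ↦ φ.symm (Ψ.symm w)) Ψ.target :=
      (continuousOn_extChartAt_symm x₀).comp Ψ.continuousOn_symm fun w hw ↦ hΨt (Ψ.map_target hw)
    exact this.congr fun w _ ↦ hΦi w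
  obtain ⟨f₀, hf₀, hfK⟩ : ∃ f₀ : ℝ, 0 < f₀ ∧ ∀ w ∈ K₂, f₀ ≤ f (Φi w) := by
    have hKi : IsCompact (Φi '' K₂) := hK₂c.image_of_continuousOn (hΦic.mono hK₂t)
    have hne : (Φi '' K₂).Nonempty := ⟨Φi z, mem_image_of_mem _ (mem_closedBall_self (by positivity))⟩
    obtain ⟨p₀, -, hp₀⟩ := hKi.exists_isMinOn hne hf.continuous.continuousOn
    exact ⟨f p₀, hfpos p₀, fun w hw ↦ hp₀ (mem_image_of_mem _ hw)⟩
  set lam : ℝ := lamρ * f₀ * lamM with hlam_def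
  have hlam : 0 < lam := by positivity
  have hell : ∀ y ∈ K₂, ∀ ξ : EuclideanSpace ℝ (Fin m), lam * ‖ξ‖ ^ 2 ≤ ⟪A₀ y ξ, ξ⟫ := by
    intro y hy ξ
    have h1 : lamM * ‖ξ‖ ^ 2 ≤ ⟪Mf y ξ, ξ⟫ := by rw [hMf]; exact (hMb y hy ξ).1
    have h2 : lamρ ≤ ρ y := by rw [hρ]; exact (hdens y hy).1
    have h3 : f₀ ≤ f (Φi y) := hfK y hy
    have h0 : 0 ≤ ⟪Mf y ξ, ξ⟫ := le_trans (by positivity) h1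
    rw [hA₀_apply, FunLike.coe_smul, Pi.smul_apply, real_inner_smul_left, hlam_def]
    calc lamρ * f₀ * lamM * ‖ξ‖ ^ 2 = (lamρ * f₀) * (lamM * ‖ξ‖ ^ 2) := by ring
      _ ≤ (ρ y * f (Φi y)) * ⟪Mf y ξ, ξ⟫ :=
          mul_le_mul (mul_le_mul h2 h3 hf₀.le (hlamρ.le.trans h2)) h1 (by positivity)
            (mul_nonneg (hlamρ.le.trans h2) (hf₀.le.trans h3))
  /- Step 4: the `L²` boundary regularity: a `C²` representative on `U_{r/2}` -/
  have hrR₂ : r < R / 2 := by rw [hr_def]; linarith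
  have hR₂R : R / 2 < R := by linarith
  have hW' : HasWeakFDerivOn (halfBall ν z r) volume ut (fun y ↦ innerSL ℝ (gu y)) := hW
  have hweak' : ∀ ζ : EuclideanSpace ℝ (Fin m) → ℝ, ContDiff ℝ ∞ ζ → HasCompactSupport ζ →
      tsupport ζ ⊆ ball z r →
      ∫ y in (halfBall ν z r : Set (EuclideanSpace ℝ (Fin m))), fderiv ℝ ζ y (A₀ y (gu y)) =
        ∫ y in (halfBall ν z r : Set (EuclideanSpace ℝ (Fin m))), FE y * ζ y := by
    intro ζ hζ hζc hζt
    have h1 := hweakE ζ hζ hζc hζt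
    have hQm : MeasurableSet Q := hQo.measurableSet
    rw [show (halfBall ν z r : Set (EuclideanSpace ℝ (Fin m))) = Q from rfl]
    have eL : ∫ y in Q, fderiv ℝ ζ y (A₀ y (gu y)) = ∫ w in Q, fderiv ℝ ζ w
        (((|(fderiv ℝ Ψ.symm w).det| * Real.sqrt (chartGramMatrix h x₀ (Ψ.symm w)).det) *
          f (φ.symm (Ψ.symm w))) •
          (∑ i, ∑ j, (chartGramMatrix h x₀ (Ψ.symm w))⁻¹ i j •
            (innerSL ℝ (fderiv ℝ Ψ (Ψ.symm w) (EuclideanSpace.single i 1))).smulRight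
              (fderiv ℝ Ψ (Ψ.symm w) (EuclideanSpace.single j 1))) (gu w)) :=
      setIntegral_congr_fun hQm fun y _ ↦ by
        rw [hA₀_apply, FunLike.coe_smul, Pi.smul_apply, hρ, hMf, hΦi]
    have eR : ∫ y in Q, FE y * ζ y = ∫ w in Q, -((|(fderiv ℝ Ψ.symm w).det| *
        Real.sqrt (chartGramMatrix h x₀ (Ψ.symm w)).det) * F (φ.symm (Ψ.symm w))) * ζ w :=
      setIntegral_congr_fun hQm fun y _ ↦ by rw [hFE_apply, hρ, hΦi]
    rw [eL, eR]
    exact h1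
  obtain ⟨A, hA, hAA₀, -, hsol, hreps⟩ := exists_contDiff_rep_of_weakNeumann_local_four hm4 hν
    hr hrR₂ hR₂R hA₀ hlam hell hFE hutm hgum hW' hweak'
  have hr2 : 0 < r / 2 := by positivity
  have hr2r : r / 2 < r := by linarith
  obtain ⟨vE, hvE, huv⟩ := hreps 2 (r / 2) hr2 hr2r
  have hvE1 : ContDiff ℝ 1 vE := hvE.of_le (by norm_cast)
  /- Step 5: the conormal boundary condition in the chart -/
  set U₂ : Opens (EuclideanSpace ℝ (Fin m)) := halfBall ν z (r / 2) with hU₂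
  have hU₂m : MeasurableSet (U₂ : Set (EuclideanSpace ℝ (Fin m))) := U₂.isOpen.measurableSet
  have hU₂U : U₂ ≤ halfBall ν z r := halfBall_mono hr2r.le
  -- `gu = ∇vE` a.e. on `U₂`
  have hgu_ae : ∀ᵐ y ∂(volume.restrict (U₂ : Set (EuclideanSpace ℝ (Fin m)))),
      gu y = gradient vE y := by
    have hW2 : HasWeakFDerivOn U₂ volume ut (fun y ↦ innerSL ℝ (gu y)) :=
      HasWeakFDerivOn.mono_set_holds hW' hU₂U
    have hW3 : HasWeakFDerivOn U₂ volume vE (fun y ↦ innerSL ℝ (gu y)) :=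
      MeyersSerrin.hasWeakFDerivOn_congr_ae hW2 huv.symm EventuallyEq.rfl
    have hW4 : HasWeakFDerivOn U₂ volume vE (fderiv ℝ vE) :=
      HasWeakFDerivOn.of_contDiff_holds _ _ hvE1
    have huniq := HasWeakFDerivOn.unique_holds hW3 hW4
    filter_upwards [huniq] with y hy
    rw [gradient, ← hy]
    exact ((InnerProductSpace.toDual ℝ _).symm_apply_apply (gu y)).symm
  have hweakY : ∀ ζ : EuclideanSpace ℝ (Fin m) → ℝ, ContDiff ℝ ∞ ζ → HasCompactSupport ζ →
      tsupport ζ ⊆ ball z (r / 2) →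
      ∫ y in (U₂ : Set (EuclideanSpace ℝ (Fin m))), fderiv ℝ ζ y (A y (gradient vE y)) =
        ∫ y in (U₂ : Set (EuclideanSpace ℝ (Fin m))), FE y * ζ y := by
    intro ζ hζ hζc hζt
    have h1 := hsol.weak_eq ζ hζ hζc (hζt.trans (ball_subset_ball hr2r.le))
    have hzero : ∀ y, y ∉ ball z (r / 2) → ζ y = 0 := fun y hy ↦
      image_eq_zero_of_notMem_tsupport fun h' ↦ hy (hζt h')
    have hdzero : ∀ y, y ∉ ball z (r / 2) → fderiv ℝ ζ y = 0 := fun y hy ↦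
      image_eq_zero_of_notMem_tsupport fun h' ↦ hy (hζt (tsupport_fderiv_subset ℝ h'))
    have hsdiff : ∀ y ∈ (halfBall ν z r : Set (EuclideanSpace ℝ (Fin m))) \ (U₂ : Set _),
        y ∉ ball z (r / 2) := fun y hy hyb ↦ hy.2 (mem_halfBall.2 ⟨hyb, (mem_halfBall.1 hy.1).2⟩)
    have eL : ∫ y in (halfBall ν z r : Set (EuclideanSpace ℝ (Fin m))), fderiv ℝ ζ y (A y (gu y)) =
        ∫ y in (U₂ : Set (EuclideanSpace ℝ (Fin m))), fderiv ℝ ζ y (A y (gu y)) :=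
      setIntegral_eq_of_subset_of_forall_sdiff_eq_zero (halfBall ν z r).isOpen.measurableSet hU₂U
        fun y hy ↦ by rw [hdzero y (hsdiff y hy)]; rfl
    have eR : ∫ y in (halfBall ν z r : Set (EuclideanSpace ℝ (Fin m))),
        (FE y * ζ y + fderiv ℝ ζ y ((fun _ ↦ (0 : EuclideanSpace ℝ (Fin m))) y)) =
        ∫ y in (U₂ : Set (EuclideanSpace ℝ (Fin m))), FE y * ζ y := by
      rw [setIntegral_eq_of_subset_of_forall_sdiff_eq_zero (halfBall ν z r).isOpen.measurableSet
        hU₂U fun y hy ↦ by rw [hzero y (hsdiff y hy), map_zero, mul_zero, add_zero]]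
      exact setIntegral_congr_fun hU₂m fun y _ ↦ by rw [map_zero, add_zero]
    rw [eL, eR] at h1
    rw [← h1]
    refine setIntegral_congr_ae hU₂m ?_
    have := (ae_restrict_iff' hU₂m).1 hgu_ae
    filter_upwards [this] with y hy hyU
    rw [hy hyU]
  have hgradvE : ContDiff ℝ 1 (gradient vE) := by
    have : ContDiff ℝ 1 (fderiv ℝ vE) := hvE.fderiv_right (by norm_cast)
    exact (InnerProductSpace.toDual ℝ (EuclideanSpace ℝ (Fin m))).symm.contDiff.comp this
  have hY : ContDiff ℝ 1 fun y ↦ A y (gradient vE y) :=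
    (hA.of_le (by exact_mod_cast le_top)).clm_apply hgradvE
  have hFEc : ContinuousOn FE (ball z (r / 2)) :=
    hFE.continuousOn.mono (ball_subset_ball (by linarith))
  have hBC : ∀ y₀ ∈ ball z (r / 2), ⟪y₀ - z, ν⟫ = 0 → ⟪A y₀ (gradient vE y₀), ν⟫ = 0 :=
    fun y₀ hy₀ hflat ↦ inner_eq_zero_of_weak_halfBall (n := 3) (by rw [hm4]) hν hr2 hY hFEc hweakY
      hy₀ hflat
  /- Step 6: the function on the manifold and the cut-off -/
  have hB2t : ball z (r / 2) ⊆ Ψ.target := (ball_subset_ball hr2r.le).trans hBt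
  set V₀ : Set M := φ.source ∩ φ ⁻¹' (Ψ.symm '' ball z (r / 2)) with hV₀
  have hV₀o : IsOpen V₀ := isOpen_compositePiece isOpen_ball hB2t
  have hx₀V₀ : x₀ ∈ V₀ := mem_compositePiece hzΨ hΨz (mem_ball_self hr2)
  set wloc : M → ℝ := fun p ↦ vE (Ψ (φ p)) with hwloc
  have hwloc_at : ∀ p ∈ V₀, ContMDiffAt (𝓡 m) 𝓘(ℝ, ℝ) 2 wloc p := by
    rintro p ⟨hps, w₀, hw₀, hw₀p⟩
    have hφp : φ p ∈ Ψ.source := by rw [← hw₀p]; exact Ψ.map_target (hB2t hw₀)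
    have h1 : ContMDiffAt (𝓡 m) 𝓘(ℝ, EuclideanSpace ℝ (Fin m)) 2 φ p :=
      contMDiffAt_extChartAt' (by rwa [← extChartAt_source (I := 𝓡 m)])
    have h2 : ContDiffAt ℝ 2 Ψ (φ p) :=
      ((hΨ.of_le (by norm_cast)).contDiffAt (Ψ.open_source.mem_nhds hφp))
    have h3 : ContDiffAt ℝ 2 (vE ∘ Ψ) (φ p) := hvE.contDiffAt.comp _ h2
    exact h3.contMDiffAt.comp p h1
  obtain ⟨θ, V, hθ, hVo, hxV, hVV₀, hθ1, hθs⟩ := exists_cutoff_one_nhds (m := m) hV₀o hx₀V₀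
  set w : M → ℝ := fun p ↦ θ p * wloc p with hw
  have hwC : ContMDiff (𝓡 m) 𝓘(ℝ, ℝ) 2 w := by
    refine contMDiff_of_tsupport fun p hp ↦ ?_
    have hp' : p ∈ V₀ := hθs ((tsupport_mul_subset_left (f := θ) (g := wloc)) hp)
    exact ((hθ.of_le (by norm_cast)).contMDiffAt).mul (hwloc_at p hp')
  refine ⟨V, hVo, hxV, w, hwC, ?_, ?_⟩
  · /- Step 7: `w = v` a.e. on `V ∩ D` -/
    have huv' : ∀ᵐ y ∂(volume : Measure (EuclideanSpace ℝ (Fin m))),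
        y ∈ (U₂ : Set (EuclideanSpace ℝ (Fin m))) → ut y = vE y := (ae_restrict_iff' hU₂m).1 huv
    have hT := ae_compositePiece_of_ae h x₀ hΨ'd
      (halfBall_subset_ball.trans hB2t : (U₂ : Set _) ⊆ Ψ.target) huv'
    filter_upwards [hae, hT] with p hp1 hp2 hpV hpσ
    -- `p` lies in the piece over `U₂`
    have hpD : p ∈ D ∩ (φ.source ∩ φ ⁻¹' (Ψ.symm '' ball z (r / 2))) := ⟨hpσ, hVV₀ hpV⟩
    rw [hD, sublevel_inter_compositePiece hlin hB2t] at hpD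
    have hpU₂ : p ∈ φ.source ∩ φ ⁻¹' (Ψ.symm '' (U₂ : Set (EuclideanSpace ℝ (Fin m)))) := hpD
    have hpQ : p ∈ φ.source ∩ φ ⁻¹' (Ψ.symm '' Q) := by
      refine ⟨hpU₂.1, ?_⟩
      have hle : (U₂ : Set (EuclideanSpace ℝ (Fin m))) ⊆ Q := fun y hy ↦ hU₂U hy
      have hsub : Ψ.symm '' (U₂ : Set (EuclideanSpace ℝ (Fin m))) ⊆ Ψ.symm '' Q :=
        image_mono hle
      exact hsub hpU₂.2
    show θ p * vE (Ψ (φ p)) = v p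
    rw [hθ1 p hpV, one_mul, ← hp2 hpU₂, hp1 hpQ]
  · /- Step 8: the boundary condition on the manifold -/
    intro q hqV hσq
    obtain ⟨hqs, w₀, hw₀, hw₀q⟩ := hVV₀ hqV
    have hw₀t : w₀ ∈ Ψ.target := hB2t hw₀
    have hΨq : Ψ (φ q) = w₀ := by rw [← hw₀q, Ψ.right_inv hw₀t]
    have hq_eq : q = φ.symm (Ψ.symm w₀) := by rw [hw₀q, φ.left_inv hqs]
    -- `dw = d wloc` at `q`
    have hev : w =ᶠ[𝓝 q] wloc := by
      filter_upwards [hVo.mem_nhds hqV] with p hp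
      show θ p * wloc p = wloc p
      rw [hθ1 p hp, one_mul]
    have hwq : w q = wloc q := hev.self_of_nhds
    have hdw : mvfderiv (𝓡 m) w q = mvfderiv (𝓡 m) wloc q := by
      unfold mvfderiv; rw [hev.mfderiv_eq, hwq]
    rw [hdw]
    -- the flat boundary condition at `w₀`
    have hflat : ⟪w₀ - z, ν⟫ = 0 := by
      rw [← sigma_eq_zero_iff_of_mem_compositePiece hlin hqs hw₀t hw₀q]; exact hσq
    have hBC₀ := hBC w₀ hw₀ hflat
    have hw₀r : w₀ ∈ closedBall z r := (ball_subset_ball hr2r.le).trans ball_subset_closedBall hw₀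
    rw [hAA₀ w₀ hw₀r, hA₀_apply, FunLike.coe_smul, Pi.smul_apply, real_inner_smul_left] at hBC₀
    have hρf : 0 < ρ w₀ * f (Φi w₀) := by
      refine mul_pos ?_ (hfpos _)
      rw [hρ]; exact compositeDensity_pos h x₀ hΨt hΨd hΨ'd hw₀t
    have hBC₁ : ⟪Mf w₀ (gradient vE w₀), ν⟫ = 0 := by
      rcases mul_eq_zero.1 hBC₀ with h0 | h0
      · exact absurd h0 hρf.ne'
      · exact h0
    -- the energy identity in the composite chart
    have hmd_w : MDifferentiableAt (𝓡 m) 𝓘(ℝ, ℝ) wloc (φ.symm (Ψ.symm w₀)) := by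
      rw [← hq_eq]; exact (hwloc_at q (hVV₀ hqV)).mdifferentiableAt (by norm_cast)
    have hmd_σ : MDifferentiableAt (𝓡 m) 𝓘(ℝ, ℝ) σ (φ.symm (Ψ.symm w₀)) :=
      (hσ _).mdifferentiableAt (by simp)
    have hid := innerDual_mvfderiv_compositeChart h x₀ hΨt hw₀t (hdΨ w₀ hw₀t) (hdΨ' w₀ hw₀t)
      hmd_w hmd_σ
    rw [← hq_eq] at hid
    -- the two gradients
    have hg1 : gradient (wloc ∘ φ.symm ∘ Ψ.symm) w₀ = gradient vE w₀ := by
      refine Filter.EventuallyEq.gradient_eq ?_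
      filter_upwards [Ψ.open_target.mem_nhds hw₀t] with y hy
      show vE (Ψ (φ (φ.symm (Ψ.symm y)))) = vE y
      rw [φ.right_inv (hΨt (Ψ.map_target hy)), Ψ.right_inv hy]
    have hg2 : gradient (σ ∘ φ.symm ∘ Ψ.symm) w₀ = ν := by
      rw [← gradient_inner_sub_const z ν w₀]
      refine Filter.EventuallyEq.gradient_eq ?_
      filter_upwards [Ψ.open_target.mem_nhds hw₀t] with y hy
      exact sigma_compositeChart_symm hlin hy
    rw [hg1, hg2, ← hMf] at hid
    show (ofRiemannian h).innerDual q (mvfderiv (𝓡 m) wloc q).toLinearMap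
      (mvfderiv (𝓡 m) σ q).toLinearMap = 0
    rw [hid, hBC₁]

set_option maxHeartbeats 3200000 in
/-- **Smooth representative near an interior point** (Taylor, *PDE I*, Ch. 5 §1; interior
hypoellipticity): for an interior point `x₀ ∈ D` there are an open `V ∋ x₀`, `V ⊆ D`, and
`w ∈ C²(M)` with `w = v` a.e. on `V`. [cite: TaylorPDEI2011, Ch. 5 §1, Proposition 1.6] -/
theorem exists_interior_representative [g.HasLeviCivita] (hg : g.IsRiemannian) (hm : 0 < m)
    {σ : M → ℝ} (hσ : ContMDiff (𝓡 m) 𝓘(ℝ, ℝ) ∞ σ) (hcpt : IsCompact {x | σ x ≤ 0})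
    {u : ℕ → M → ℝ} {v : M → ℝ} (hus : ∀ n, ContMDiff (𝓡 m) 𝓘(ℝ, ℝ) ∞ (u n))
    (hvm : MemLp v 2 ((riemannianMeasure (g.toContMDiffRiemannianMetric hg)).restrict {x | σ x < 0}))
    (hL2 : Tendsto (fun n ↦ eLpNorm (u n - v) 2
      ((riemannianMeasure (g.toContMDiffRiemannianMetric hg)).restrict {x | σ x < 0})) atTop (𝓝 0))
    (hE : ∀ ε > 0, ∃ N, ∀ n ≥ N, ∀ n' ≥ N, ∫ p in {x | σ x < 0}, g.gradSq (u n - u n') p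
      ∂riemannianMeasure (g.toContMDiffRiemannianMetric hg) < ε)
    {f : M → ℝ} (hf : ContMDiff (𝓡 m) 𝓘(ℝ, ℝ) ∞ f) (hfpos : ∀ x, 0 < f x)
    {F : M → ℝ} (hF : ContMDiff (𝓡 m) 𝓘(ℝ, ℝ) ∞ F)
    (hweak : ∀ w : M → ℝ, ContMDiff (𝓡 m) 𝓘(ℝ, ℝ) ∞ w →
      Tendsto (fun n ↦ ∫ p in {x | σ x < 0}, f p * g.innerDual p (mvfderiv (𝓡 m) (u n) p).toLinearMap
        (mvfderiv (𝓡 m) w p).toLinearMap ∂riemannianMeasure (g.toContMDiffRiemannianMetric hg))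
        atTop (𝓝 (-∫ p in {x | σ x < 0}, F p * w p
          ∂riemannianMeasure (g.toContMDiffRiemannianMetric hg))))
    {x₀ : M} (hx₀ : σ x₀ < 0) :
    ∃ V : Set M, IsOpen V ∧ x₀ ∈ V ∧ V ⊆ {x | σ x < 0} ∧ ∃ w : M → ℝ,
      ContMDiff (𝓡 m) 𝓘(ℝ, ℝ) 2 w ∧
      ∀ᵐ p ∂riemannianMeasure (g.toContMDiffRiemannianMetric hg), p ∈ V → w p = v p := by
  classical
  set h := g.toContMDiffRiemannianMetric hg with hh_def
  haveI : (ofRiemannian h).HasLeviCivita := ‹g.HasLeviCivita›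
  set μ : Measure M := riemannianMeasure h with hμ
  set φ := extChartAt (𝓡 m) x₀ with hφ
  set D : Set M := {x | σ x < 0} with hD
  have hDo : IsOpen D := isOpen_lt hσ.continuous continuous_const
  have hDm : MeasurableSet D := hDo.measurableSet
  have hDKD : D ⊆ {x | σ x ≤ 0} := fun x (hx : σ x < 0) ↦ hx.le
  haveI : Nontrivial (EuclideanSpace ℝ (Fin m)) := by
    have : 0 < Module.finrank ℝ (EuclideanSpace ℝ (Fin m)) := by simpa using hm
    exact Module.nontrivial_of_finrank_pos this
  /- Step 1: the identity composite chart and a ball inside `D` -/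
  have hTo : IsOpen φ.target := isOpen_extChartAt_target x₀
  set Ψ := OpenPartialHomeomorph.ofSet φ.target hTo with hΨ_def
  have hΨt : Ψ.source ⊆ φ.target := by rw [hΨ_def, OpenPartialHomeomorph.ofSet_source]
  have hΨ : ContDiffOn ℝ ∞ Ψ Ψ.source := by
    rw [hΨ_def, OpenPartialHomeomorph.ofSet_apply]; exact contDiffOn_id
  have hΨ' : ContDiffOn ℝ ∞ Ψ.symm Ψ.target := by
    rw [hΨ_def, OpenPartialHomeomorph.ofSet_symm, OpenPartialHomeomorph.ofSet_apply]
    exact contDiffOn_id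
  have hΨapply : ∀ y, Ψ y = y := fun y ↦ by rw [hΨ_def, OpenPartialHomeomorph.ofSet_apply]; rfl
  have hΨsymm : ∀ y, Ψ.symm y = y := fun y ↦ by
    rw [hΨ_def, OpenPartialHomeomorph.ofSet_symm, OpenPartialHomeomorph.ofSet_apply]; rfl
  have himg : ∀ B : Set (EuclideanSpace ℝ (Fin m)), Ψ.symm '' B = B := fun B ↦ by
    rw [hΨ_def, OpenPartialHomeomorph.ofSet_symm, OpenPartialHomeomorph.ofSet_apply, image_id]
  set z : EuclideanSpace ℝ (Fin m) := φ x₀ with hz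
  have hzT : z ∈ φ.target := φ.map_source (mem_extChartAt_source x₀)
  have hzΨ : φ x₀ ∈ Ψ.source := by rw [hΨ_def, OpenPartialHomeomorph.ofSet_source]; exact hzT
  have hΨz : Ψ (φ x₀) = φ x₀ := hΨapply _
  obtain ⟨r, hr, hball, hpiece⟩ := exists_compositePiece_ball_subset hzΨ hΨz (hDo.mem_nhds hx₀)
  have hBt : ball z r ⊆ Ψ.target := ball_subset_closedBall.trans hball
  have hΨd : DifferentiableOn ℝ Ψ Ψ.source := hΨ.differentiableOn (by simp)
  have hΨ'd : DifferentiableOn ℝ Ψ.symm Ψ.target := hΨ'.differentiableOn (by simp)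
  have hdΨ : ∀ w ∈ Ψ.target, DifferentiableAt ℝ Ψ (Ψ.symm w) := fun w hw ↦
    (hΨd _ (Ψ.map_target hw)).differentiableAt (Ψ.open_source.mem_nhds (Ψ.map_target hw))
  have hdΨ' : ∀ w ∈ Ψ.target, DifferentiableAt ℝ Ψ.symm w := fun w hw ↦
    (hΨ'd _ hw).differentiableAt (Ψ.open_target.mem_nhds hw)
  set Q : Set (EuclideanSpace ℝ (Fin m)) := ball z r with hQ
  have hQo : IsOpen Q := isOpen_ball
  have hQm : MeasurableSet Q := hQo.measurableSet
  have hDQ : D ∩ (φ.source ∩ φ ⁻¹' (Ψ.symm '' ball z r)) = φ.source ∩ φ ⁻¹' (Ψ.symm '' Q) :=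
    inter_eq_right.2 hpiece
  /- Step 2: the chart transfer -/
  obtain ⟨ut, gu, hutm, hgum, hW, hae, -, -, hweakE⟩ := exists_weakNeumann_chartTransfer g hg x₀
    hΨt hΨ hΨ' hball hQo subset_rfl hDm hcpt hDKD hDQ hus hvm hL2 hE hf.continuous hF.continuous
    hweak
  /- Step 3: the coefficients and the interior regularity -/
  obtain ⟨ρ, hρ⟩ : ∃ ρ : EuclideanSpace ℝ (Fin m) → ℝ, ∀ w, ρ w =
      |(fderiv ℝ Ψ.symm w).det| * Real.sqrt (chartGramMatrix h x₀ (Ψ.symm w)).det :=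
    ⟨_, fun _ ↦ rfl⟩
  obtain ⟨Mf, hMf⟩ : ∃ Mf : EuclideanSpace ℝ (Fin m) → EuclideanSpace ℝ (Fin m) →L[ℝ]
      EuclideanSpace ℝ (Fin m), ∀ w, Mf w = ∑ i, ∑ j, (chartGramMatrix h x₀ (Ψ.symm w))⁻¹ i j •
        (innerSL ℝ (fderiv ℝ Ψ (Ψ.symm w) (EuclideanSpace.single i 1))).smulRight
          (fderiv ℝ Ψ (Ψ.symm w) (EuclideanSpace.single j 1)) := ⟨_, fun _ ↦ rfl⟩
  obtain ⟨Φi, hΦi⟩ : ∃ Φi : EuclideanSpace ℝ (Fin m) → M, ∀ w, Φi w = φ.symm (Ψ.symm w) :=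
    ⟨_, fun _ ↦ rfl⟩
  obtain ⟨A₀, hA₀_apply⟩ : ∃ A₀ : EuclideanSpace ℝ (Fin m) → EuclideanSpace ℝ (Fin m) →L[ℝ]
      EuclideanSpace ℝ (Fin m), ∀ w, A₀ w = (ρ w * f (Φi w)) • Mf w := ⟨_, fun _ ↦ rfl⟩
  obtain ⟨FE, hFE_apply⟩ : ∃ FE : EuclideanSpace ℝ (Fin m) → ℝ, ∀ w, FE w = -(ρ w * F (Φi w)) :=
    ⟨_, fun _ ↦ rfl⟩
  have hρs : ContDiffOn ℝ ∞ ρ Q :=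
    (contDiffOn_compositeDensity_of_convex h x₀ hΨt hΨ hΨ' (convex_ball z r) hBt).congr
      fun w _ ↦ hρ w
  have hMs : ContDiffOn ℝ ∞ Mf Ψ.target :=
    (contDiffOn_compositeCoeff h x₀ hΨt hΨ hΨ').congr fun w _ ↦ hMf w
  have hcompΦ : ∀ {k : M → ℝ}, ContMDiff (𝓡 m) 𝓘(ℝ, ℝ) ∞ k →
      ContDiffOn ℝ ∞ (fun w ↦ k (Φi w)) Ψ.target := by
    intro k hk
    have h1 : ContDiffOn ℝ ∞ (k ∘ φ.symm) φ.target := contDiffOn_comp_extChartAt_symm hk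
    have h2 := h1.comp hΨ' fun w hw ↦ hΨt (Ψ.map_target hw)
    exact h2.congr fun w _ ↦ by rw [hΦi]; rfl
  have hA₀ : ContDiffOn ℝ ∞ A₀ Q := by
    have := (hρs.mul ((hcompΦ hf).mono hBt)).smul (hMs.mono hBt)
    exact this.congr fun w _ ↦ hA₀_apply w
  have hFE : ContDiffOn ℝ ∞ FE Q := by
    have := (hρs.mul ((hcompΦ hF).mono hBt)).neg
    exact this.congr fun w _ ↦ hFE_apply w
  have hsym : ∀ y ∈ Q, ∀ ξ η : EuclideanSpace ℝ (Fin m), ⟪A₀ y ξ, η⟫ = ⟪ξ, A₀ y η⟫ := by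
    intro y _ ξ η
    rw [hA₀_apply, FunLike.coe_smul, Pi.smul_apply, Pi.smul_apply, real_inner_smul_left,
      real_inner_smul_right, hMf, compositeCoeff_inner_symm h x₀ Ψ y]
  have hell : ∀ y ∈ Q, ∀ ξ : EuclideanSpace ℝ (Fin m), ξ ≠ 0 → 0 < ⟪A₀ y ξ, ξ⟫ := by
    intro y hy ξ hξ
    rw [hA₀_apply, FunLike.coe_smul, Pi.smul_apply, real_inner_smul_left]
    refine mul_pos (mul_pos ?_ (hfpos _)) ?_
    · rw [hρ]; exact compositeDensity_pos h x₀ hΨt hΨd hΨ'd (hBt hy)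
    · rw [hMf]; exact compositeCoeff_inner_self_pos h x₀ hΨt (hBt hy) (hdΨ y (hBt hy))
        (hdΨ' y (hBt hy)) hξ
  have hvolQ : volume Q < ⊤ := measure_ball_lt_top
  haveI : IsFiniteMeasure (volume.restrict Q) := ⟨by rwa [Measure.restrict_apply_univ]⟩
  have hguL : LocallyIntegrableOn gu Q volume := by
    have : IntegrableOn gu Q volume := hgum.integrable one_le_two
    exact this.locallyIntegrableOn
  have hweak' : ∀ ζ : EuclideanSpace ℝ (Fin m) → ℝ, ContDiff ℝ ∞ ζ → HasCompactSupport ζ →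
      tsupport ζ ⊆ Q →
      ∫ y in Q, fderiv ℝ ζ y (A₀ y (gu y)) = ∫ y in Q, FE y * ζ y := by
    intro ζ hζ hζc hζt
    have h1 := hweakE ζ hζ hζc hζt
    have eL : ∫ y in Q, fderiv ℝ ζ y (A₀ y (gu y)) = ∫ w in Q, fderiv ℝ ζ w
        (((|(fderiv ℝ Ψ.symm w).det| * Real.sqrt (chartGramMatrix h x₀ (Ψ.symm w)).det) *
          f (φ.symm (Ψ.symm w))) •
          (∑ i, ∑ j, (chartGramMatrix h x₀ (Ψ.symm w))⁻¹ i j •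
            (innerSL ℝ (fderiv ℝ Ψ (Ψ.symm w) (EuclideanSpace.single i 1))).smulRight
              (fderiv ℝ Ψ (Ψ.symm w) (EuclideanSpace.single j 1))) (gu w)) :=
      setIntegral_congr_fun hQm fun y _ ↦ by
        rw [hA₀_apply, FunLike.coe_smul, Pi.smul_apply, hρ, hMf, hΦi]
    have eR : ∫ y in Q, FE y * ζ y = ∫ w in Q, -((|(fderiv ℝ Ψ.symm w).det| *
        Real.sqrt (chartGramMatrix h x₀ (Ψ.symm w)).det) * F (φ.symm (Ψ.symm w))) * ζ w :=
      setIntegral_congr_fun hQm fun y _ ↦ by rw [hFE_apply, hρ, hΦi]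
    rw [eL, eR]
    exact h1
  obtain ⟨U, hUo, hzU, hUQ, wE, hwE, haeU⟩ := exists_contDiffOn_rep_of_divForm_weakFDeriv volume
    (EuclideanSpace.basisFun (Fin m) ℝ) hQo hA₀ hsym hell hFE hW hguL hweak' (mem_ball_self hr)
  /- Step 4: the function on the manifold and the cut-off -/
  have hUt : U ⊆ Ψ.target := hUQ.trans hBt
  set V₀ : Set M := φ.source ∩ φ ⁻¹' (Ψ.symm '' U) with hV₀
  have hV₀o : IsOpen V₀ := isOpen_compositePiece hUo hUt
  have hx₀V₀ : x₀ ∈ V₀ := mem_compositePiece hzΨ hΨz hzU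
  have hV₀D : V₀ ⊆ D := by
    refine Subset.trans ?_ hpiece
    rintro p ⟨hps, hp⟩
    exact ⟨hps, image_mono hUQ hp⟩
  set wloc : M → ℝ := fun p ↦ wE (Ψ (φ p)) with hwloc
  have hwloc_at : ∀ p ∈ V₀, ContMDiffAt (𝓡 m) 𝓘(ℝ, ℝ) 2 wloc p := by
    rintro p ⟨hps, w₀, hw₀, hw₀p⟩
    rw [hΨsymm] at hw₀p
    have hφp : φ p ∈ U := by rw [← hw₀p]; exact hw₀
    have h1 : ContMDiffAt (𝓡 m) 𝓘(ℝ, EuclideanSpace ℝ (Fin m)) 2 φ p :=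
      contMDiffAt_extChartAt' (by rwa [← extChartAt_source (I := 𝓡 m)])
    have h2 : ContDiffAt ℝ 2 wE (φ p) := (hwE.of_le (by norm_cast)).contDiffAt (hUo.mem_nhds hφp)
    have e : wloc = wE ∘ φ := funext fun q ↦ by simp only [hwloc, comp_apply, hΨapply]
    rw [e]
    exact h2.contMDiffAt.comp p h1
  obtain ⟨θ, V, hθ, hVo, hxV, hVV₀, hθ1, hθs⟩ := exists_cutoff_one_nhds (m := m) hV₀o hx₀V₀
  set w : M → ℝ := fun p ↦ θ p * wloc p with hw
  have hwC : ContMDiff (𝓡 m) 𝓘(ℝ, ℝ) 2 w := by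
    refine contMDiff_of_tsupport fun p hp ↦ ?_
    have hp' : p ∈ V₀ := hθs ((tsupport_mul_subset_left (f := θ) (g := wloc)) hp)
    exact ((hθ.of_le (by norm_cast)).contMDiffAt).mul (hwloc_at p hp')
  refine ⟨V, hVo, hxV, hVV₀.trans hV₀D, w, hwC, ?_⟩
  /- Step 5: `w = v` a.e. on `V` -/
  have hT := ae_compositePiece_of_ae h x₀ hΨ'd hUt haeU
  filter_upwards [hae, hT] with p hp1 hp2 hpV
  have hpU : p ∈ V₀ := hVV₀ hpV
  have hpQ : p ∈ φ.source ∩ φ ⁻¹' (Ψ.symm '' Q) := ⟨hpU.1, image_mono hUQ hpU.2⟩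
  show θ p * wE (Ψ (φ p)) = v p
  rw [hθ1 p hpV, one_mul, ← hp2 hpU, hp1 hpQ]

end Literature.Geometry.Riemannian

end
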